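import Summits.CriticalPhenomena.SAWScalingLimit.Theorems.SAWLoopFugacityFlowAvoidanceLimitAnchorDefs
import Literature.Probability.RandomPlanarGeometry.ExcursionRestrictionHarmonic
import Mathlib.Analysis.Complex.RemovableSingularity
import Mathlib.Analysis.SpecialFunctions.Log.Deriv

/-!
# The continuum excursion ratio: `G_{ℍ∖A}(u,v)/G_ℍ(u,v) → Φ'_A(0)` as `u → 0`, `v → ∞`
— helper file 3 of stub `stub_excursionRatio` of line `symplectic-fermion-anchor`
(crux `SAWLoopFugacityFlow.AvoidanceLimit`, stmt-CriticalPhenomena-10649)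

The continuum half of the stub `stub_excursionRatio` in Green's-function language. For a `*`-hull
`A` with restriction data `(Φ, d)` (`IsRestrictionMap A Φ`, `HasRestrictionDeriv A Φ d`: the map
`Φ_A : ℍ ∖ A → ℍ`, `Φ(0) = 0`, `Φ(z)/z → 1` at `∞`, `d = Φ'_A(0)`), the Green's function of the
half-plane is `G_ℍ(x, y) = log (|x − ȳ|/|x − y|)` and, by conformal invariance,
`G_{ℍ∖A}(u, v) = G_ℍ(Φu, Φv)`. We prove

* `abs_im_div_im_sub_one_le` / `tendsto_im_div_im_cocompact` — **`Im Φ_A(z)/Im z → 1` as `z → ∞`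
  in ALL directions inside `ℍ ∖ A`** (also tangentially, `Im z` bounded): the Schwarz reflection
  `E = hullExt Φ` of the tree (`StarHullExtension`) has `E(z) − z → L ∈ ℝ` at `∞`; the inverted
  remainder `N(ζ) = E(1/ζ) − 1/ζ` has a removable singularity at `0` (Mathlib's
  `Complex.differentiableOn_update_limUnder_of_isLittleO`), is strictly differentiable there and
  conjugation-symmetric, so `Im Φ(z) − Im z = Im N(1/z) = O(Im(1/z)) = O(Im z/|z|²)`;
* `log_norm_sub_conj_div` — `G_ℍ(x, y) = ½ log (1 + 4 Im x Im y/|x − y|²)`;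
* the registered closing theorem `tendsto_greenHalfPlane_ratio`:
  **`G_{ℍ∖A}(u, v)/G_ℍ(u, v) → d`** along `u → 0`, `v → ∞` inside `ℍ ∖ A` (product filter), from
  `Im Φ(u)/Im u → d` (the tree's `IsRestrictionMap.tendsto_im_div_im_nhdsWithin_zero`, uniform in
  the direction of approach), the previous item at `∞`, `Φ(u) → 0`, `Φ(v)/v → 1`, and
  `log(1 + s) ∼ s`.

This is the value `H_{D'}(a,b)/H_D(a,b) = Φ'_A(0)` of the restriction exponent `1` (the Brownian
excursion from `a` to `b` in `D` stays in the hull subdomain `D'` with probability `Φ'_A(0)`,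
[LSW] Prop. 4.1) read on Green's functions near the two marked prime ends, in the form the lattice
statement `stub_excursionRatio` needs: uniform in HOW `u → 0` and `v → ∞` (tangential and
mesoscopic approaches included), which is what an arbitrary endpoint approximation `a_δ, b_δ`
produces after uniformization.

Sources: G. F. Lawler, O. Schramm, W. Werner, *Conformal restriction: the chordal case*, JAMS 16
(2003), §2 and Prop. 4.1 [LawlerSchrammWerner2003Restriction]; G. F. Lawler, *Conformally
Invariant Processes in the Plane* (2005), §3.4 Prop. 3.36 (expansion at `∞`) [Lawler2005]; the
Green's function of `ℍ`: folklore. No definitions.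
-/

noncomputable section

open scoped BigOperators Topology symmDiff ComplexConjugate
open Filter Finset
open Literature.Probability.RandomPlanarGeometry Literature.Probability.LatticeModels

namespace Summit.CriticalPhenomena.SAWScalingLimit.Theorems.AvoidanceLimit.Anchor

section Infinity

variable {B : Set ℂ} {Φ : ConformalEquiv (UpperHalfPlane.upperHalfPlaneSet \ B) UpperHalfPlane.upperHalfPlaneSet}

/-- **`Im Φ_B(z)/Im z = 1 + O(|z|⁻²)` at `∞`, in all directions inside `ℍ ∖ B`.** With
`E = hullExt Φ` (Schwarz reflection, holomorphic and conjugation-symmetric outside a disc,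
`E(z) − z → L ∈ ℝ`), the inverted remainder `N(ζ) = E(1/ζ) − 1/ζ` extends holomorphically to
`ζ = 0` (removable singularity), hence is strictly differentiable at `0`; as `N(ζ̄) = conj N(ζ)`,
`2i (Im Φ(z) − Im z) = N(1/z) − N(1/z̄) = (1/z − 1/z̄)·N'(0) + o(|1/z − 1/z̄|)` and
`|1/z − 1/z̄| = 2 Im z/|z|²`. [cite: Lawler2005, §3.4 proof of Prop. 3.36] -/
theorem abs_im_div_im_sub_one_le (hB : IsBoundedHull B) (hΦ : IsRestrictionMap B Φ) :
    ∃ C R : ℝ, 0 < R ∧ ∀ z ∈ UpperHalfPlane.upperHalfPlaneSet \ B, R < ‖z‖ →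
      |(Φ z).im / z.im - 1| ≤ C / ‖z‖ ^ 2 := by
  obtain ⟨R, hR, hRΩ⟩ := exists_forall_mem_symmDomain hB
  set M : ℂ → ℂ := fun ζ ↦ hullExt Φ ζ⁻¹ - ζ⁻¹ with hM
  -- `M` is holomorphic on the punctured disc `0 < |ζ| < 1/R`
  have hMd : ∀ ζ : ℂ, ζ ≠ 0 → ‖ζ‖ < R⁻¹ → DifferentiableAt ℂ M ζ := by
    intro ζ hζ0 hζR
    have hz : R < ‖ζ⁻¹‖ := by
      rw [norm_inv]
      rwa [lt_inv_comm₀ hR (norm_pos_iff.2 hζ0)]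
    exact ((differentiableAt_hullExt hB hΦ (hRΩ _ hz)).comp ζ (differentiableAt_inv hζ0)).sub
      (differentiableAt_inv hζ0)
  have hd : DifferentiableOn ℂ M (Metric.ball (0 : ℂ) R⁻¹ \ {0}) := fun ζ hζ =>
    (hMd ζ hζ.2 (mem_ball_zero_iff.1 hζ.1)).differentiableWithinAt
  -- `M ζ - M 0 = o(1/ζ)`: indeed `ζ (M ζ - M 0) → 0` (as in `tendsto_hullExt_sub_self`)
  have ho : (fun ζ ↦ M ζ - M 0) =o[𝓝[≠] (0 : ℂ)] fun ζ ↦ (ζ - 0)⁻¹ := by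
    simp only [sub_zero]
    refine (Asymptotics.isLittleO_iff_tendsto' ?_).2 ?_
    · filter_upwards [self_mem_nhdsWithin] with ζ hζ h
      exact absurd (inv_eq_zero.1 h) hζ
    · have h1 : Tendsto (fun z ↦ hullExt Φ z / z - 1) (cocompact ℂ) (𝓝 0) := by
        have := (tendsto_hullExt_div hB hΦ).sub (tendsto_const_nhds (x := (1 : ℂ)))
        rwa [sub_self] at this
      have h2 : Tendsto (fun ζ : ℂ ↦ ζ⁻¹) (𝓝[≠] 0) (cocompact ℂ) := by
        rw [← Metric.cobounded_eq_cocompact]; exact tendsto_inv₀_nhdsNE_zero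
      have h3 := h1.comp h2
      have h4 : Tendsto (fun ζ : ℂ ↦ ζ * M 0) (𝓝[≠] 0) (𝓝 0) := by
        have : Tendsto (fun ζ : ℂ ↦ ζ * M 0) (𝓝 0) (𝓝 (0 * M 0)) :=
          ((continuous_id.mul continuous_const).tendsto 0)
        rw [zero_mul] at this
        exact this.mono_left nhdsWithin_le_nhds
      have h5 := h3.sub h4
      rw [sub_zero] at h5
      have hM0 : M 0 = hullExt Φ 0 := by simp [hM]
      refine h5.congr' ?_
      filter_upwards [self_mem_nhdsWithin] with ζ hζ
      have hζ0 : ζ ≠ 0 := hζ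
      rw [hM0]
      simp only [Function.comp_apply, hM]
      field_simp
  -- the removable extension `N` and its strict derivative at `0`
  set N : ℂ → ℂ := Function.update M 0 (limUnder (𝓝[≠] (0 : ℂ)) M) with hN
  have hball : Metric.ball (0 : ℂ) R⁻¹ ∈ 𝓝 (0 : ℂ) := Metric.ball_mem_nhds _ (inv_pos.2 hR)
  have hNd : DifferentiableOn ℂ N (Metric.ball (0 : ℂ) R⁻¹) :=
    Complex.differentiableOn_update_limUnder_of_isLittleO hball hd ho
  have hcd : ContDiffAt ℂ ⊤ N 0 := (hNd.contDiffOn Metric.isOpen_ball).contDiffAt hball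
  have hstrict : HasStrictDerivAt N (deriv N 0) 0 := hcd.hasStrictDerivAt (by simp)
  have hoN := (hasDerivAtFilter_iff_isLittleO.1 hstrict).def one_pos
  obtain ⟨δ, hδ, hδN⟩ := Metric.eventually_nhds_iff.1 hoN
  set c : ℂ := deriv N 0 with hc
  refine ⟨‖c‖ + 1, max R δ⁻¹, lt_max_of_lt_left hR, fun z hz hzR ↦ ?_⟩
  have hzR' : R < ‖z‖ := lt_of_le_of_lt (le_max_left _ _) hzR
  have hzδ : δ⁻¹ < ‖z‖ := lt_of_le_of_lt (le_max_right _ _) hzR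
  have hz0 : z ≠ 0 := by
    rintro rfl
    simp at hzR'
    linarith
  have hzn : 0 < ‖z‖ := norm_pos_iff.2 hz0
  have hzim : 0 < z.im := hz.1
  have hzΩ : z ∈ symmDomain B := hRΩ z hzR'
  -- the pair `(1/z, 1/z̄)` is `δ`-close to `(0, 0)`
  have hζ0 : z⁻¹ ≠ 0 := inv_ne_zero hz0
  have hζn : ‖z⁻¹‖ < δ := by
    rw [norm_inv]
    exact inv_lt_of_inv_lt₀ hδ hzδ
  have hpair : dist (z⁻¹, conj z⁻¹) ((0 : ℂ), (0 : ℂ)) < δ := by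
    rw [Prod.dist_eq, dist_zero_right, dist_zero_right, Complex.norm_conj, max_self]
    exact hζn
  have key := hδN hpair
  -- evaluate `N` at `1/z` and `1/z̄`
  have hN1 : N z⁻¹ = Φ z - z := by
    rw [hN, Function.update_of_ne hζ0]
    simp only [hM, inv_inv]
    rw [hullExt_of_mem_diff hz]
  have hcζ0 : conj z⁻¹ ≠ 0 := by
    rwa [Ne, map_eq_zero]
  have hN2 : N (conj z⁻¹) = conj (Φ z - z) := by
    rw [hN, Function.update_of_ne hcζ0]
    simp only [hM, Complex.conj_inv, inv_inv]
    rw [hullExt_conj hB hΦ hzΩ, hullExt_of_mem_diff hz, map_sub]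
  -- `N(1/z) - N(1/z̄) = 2i (Im Φ z - Im z)` and `1/z - 1/z̄ = 2i Im (1/z)`
  have hdiff : N z⁻¹ - N (conj z⁻¹) = ((2 * ((Φ z).im - z.im) : ℝ) : ℂ) * Complex.I := by
    rw [hN1, hN2, Complex.sub_conj, Complex.sub_im]
  have hdz : (z⁻¹ : ℂ) - conj z⁻¹ = ((2 * (z⁻¹).im : ℝ) : ℂ) * Complex.I := Complex.sub_conj _
  have hninv : ‖(z⁻¹ : ℂ) - conj z⁻¹‖ = 2 * z.im / ‖z‖ ^ 2 := by
    rw [hdz, norm_mul, Complex.norm_I, mul_one, Complex.norm_real, Real.norm_eq_abs, Complex.inv_im,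
      Complex.normSq_eq_norm_sq, abs_mul, abs_two, abs_div, abs_neg, abs_of_pos hzim,
      abs_of_pos (by positivity)]
    ring
  have hnum : ‖N z⁻¹ - N (conj z⁻¹)‖ = 2 * |(Φ z).im - z.im| := by
    rw [hdiff, norm_mul, Complex.norm_I, mul_one, Complex.norm_real, Real.norm_eq_abs, abs_mul,
      abs_two]
  -- the strict-derivative estimate with `ε = 1`
  have hest : ‖N z⁻¹ - N (conj z⁻¹)‖ ≤ (‖c‖ + 1) * ‖(z⁻¹ : ℂ) - conj z⁻¹‖ := by
    have h1 : ‖N z⁻¹ - N (conj z⁻¹)‖ ≤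
        ‖N z⁻¹ - N (conj z⁻¹) - ((z⁻¹ : ℂ) - conj z⁻¹) • c‖ + ‖((z⁻¹ : ℂ) - conj z⁻¹) • c‖ := by
      have := norm_add_le (N z⁻¹ - N (conj z⁻¹) - ((z⁻¹ : ℂ) - conj z⁻¹) • c)
        (((z⁻¹ : ℂ) - conj z⁻¹) • c)
      rwa [sub_add_cancel] at this
    have h2 : ‖((z⁻¹ : ℂ) - conj z⁻¹) • c‖ = ‖(z⁻¹ : ℂ) - conj z⁻¹‖ * ‖c‖ := norm_smul _ _
    have h3 : ‖N z⁻¹ - N (conj z⁻¹) - ((z⁻¹ : ℂ) - conj z⁻¹) • c‖ ≤ 1 * ‖(z⁻¹ : ℂ) - conj z⁻¹‖ := by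
      simpa using key
    nlinarith [norm_nonneg ((z⁻¹ : ℂ) - conj z⁻¹), norm_nonneg c]
  rw [hnum, hninv] at hest
  -- divide by `2 Im z > 0`
  have hq : (Φ z).im / z.im - 1 = ((Φ z).im - z.im) / z.im := by
    field_simp
  rw [hq, abs_div, abs_of_pos hzim, div_le_iff₀ hzim]
  have : (‖c‖ + 1) * (2 * z.im / ‖z‖ ^ 2) = 2 * ((‖c‖ + 1) / ‖z‖ ^ 2 * z.im) := by
    field_simp
  rw [this] at hest
  linarith

/-- **`Im Φ_B(z)/Im z → 1` as `z → ∞` inside `ℍ ∖ B`, in all directions** (also tangentially).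
[cite: Lawler2005, §3.4 proof of Prop. 3.36] -/
theorem tendsto_im_div_im_cocompact (hB : IsBoundedHull B) (hΦ : IsRestrictionMap B Φ) :
    Tendsto (fun z ↦ (Φ z).im / z.im) (cocompact ℂ ⊓ 𝓟 (UpperHalfPlane.upperHalfPlaneSet \ B))
      (𝓝 1) := by
  obtain ⟨C, R, -, h⟩ := abs_im_div_im_sub_one_le hB hΦ
  have hC : Tendsto (fun z : ℂ ↦ |C| / ‖z‖ ^ 2) (cocompact ℂ) (𝓝 0) := by
    have h1 : Tendsto (fun z : ℂ ↦ ‖z‖ ^ 2) (cocompact ℂ) atTop :=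
      (tendsto_pow_atTop two_ne_zero).comp tendsto_norm_cocompact_atTop
    exact h1.const_div_atTop |C|
  rw [Metric.tendsto_nhds]
  intro ε hε
  have hev1 : ∀ᶠ z in cocompact ℂ, |C| / ‖z‖ ^ 2 < ε := by
    have := (Metric.tendsto_nhds.1 hC) ε hε
    filter_upwards [this] with z hz
    rw [Real.dist_eq, sub_zero] at hz
    exact lt_of_abs_lt hz
  have hev2 : ∀ᶠ z in cocompact ℂ, R < ‖z‖ := tendsto_norm_cocompact_atTop.eventually_gt_atTop R
  have hev3 : ∀ᶠ z in cocompact ℂ ⊓ 𝓟 (UpperHalfPlane.upperHalfPlaneSet \ B),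
      z ∈ UpperHalfPlane.upperHalfPlaneSet \ B := mem_inf_of_right (mem_principal_self _)
  filter_upwards [mem_inf_of_left hev1, mem_inf_of_left hev2, hev3] with z hz1 hz2 hz3
  rw [Real.dist_eq]
  refine lt_of_le_of_lt (h z hz3 hz2) (lt_of_le_of_lt ?_ hz1)
  exact div_le_div_of_nonneg_right (le_abs_self C) (by positivity)

end Infinity

/-! ## The Green's function of `ℍ` and the ratio `G_{ℍ∖A}/G_ℍ` near `(0, ∞)` -/

section GreenRatio

/-- **`G_ℍ(x, y) = log (|x − ȳ|/|x − y|) = ½ log (1 + 4 Im x Im y/|x − y|²)`** (from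
`|x − ȳ|² = |x − y|² + 4 Im x Im y`). [folklore] -/
theorem log_norm_sub_conj_div {x y : ℂ} (hxy : x ≠ y) (hx : 0 ≤ x.im) (hy : 0 ≤ y.im) :
    Real.log (‖x - conj y‖ / ‖x - y‖) = Real.log (1 + 4 * x.im * y.im / ‖x - y‖ ^ 2) / 2 := by
  have hn : 0 < ‖x - y‖ := norm_pos_iff.2 (sub_ne_zero.2 hxy)
  have hsq : ‖x - conj y‖ ^ 2 = ‖x - y‖ ^ 2 * (1 + 4 * x.im * y.im / ‖x - y‖ ^ 2) := by
    rw [HalfPlanePick.norm_sub_conj_sq]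
    field_simp
  have hpos : 0 < 1 + 4 * x.im * y.im / ‖x - y‖ ^ 2 := by positivity
  have h1 : ‖x - conj y‖ = ‖x - y‖ * Real.sqrt (1 + 4 * x.im * y.im / ‖x - y‖ ^ 2) := by
    rw [← Real.sqrt_sq (norm_nonneg (x - conj y)), hsq, Real.sqrt_mul (sq_nonneg _),
      Real.sqrt_sq hn.le]
  rw [h1, mul_div_cancel_left₀ _ hn.ne', Real.log_sqrt hpos.le]

/-- `log (1 + s)/s → 1` as `s → 0`, `s ≠ 0` (the derivative of `log` at `1`). [folklore] -/
theorem tendsto_log_one_add_div :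
    Tendsto (fun s : ℝ => Real.log (1 + s) / s) (𝓝[≠] 0) (𝓝 1) := by
  have h := (Real.hasDerivAt_log one_ne_zero).tendsto_slope_zero
  simp only [Real.log_one, sub_zero, inv_one, smul_eq_mul] at h
  refine h.congr' (Eventually.of_forall fun s => ?_)
  show s⁻¹ * Real.log (1 + s) = Real.log (1 + s) / s
  rw [div_eq_inv_mul]

/-- **Registered closing theorem of this helper file — the continuum excursion ratio.** For a
`*`-hull `A` with restriction data `(Φ, d)`, the ratio of Green's functions
`G_{ℍ∖A}(u, v)/G_ℍ(u, v) = log(|Φu − conj Φv|/|Φu − Φv|)/log(|u − v̄|/|u − v|)` tends to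
`d = Φ'_A(0)` as `u → 0` and `v → ∞` inside `ℍ ∖ A`, in whatever manner (product of the two
filters): `G ∼ 2 Im x Im y/|x − y|²` at small ratio, `Im Φu/Im u → d`, `Im Φv/Im v → 1`,
`|Φu − Φv|/|u − v| → 1`. This is `P[excursion from 0 to ∞ in ℍ avoids A] = Φ'_A(0)` ([LSW]
Prop. 4.1) read on Green's functions. [cite: LawlerSchrammWerner2003Restriction, Prop. 4.1 (p. 16)] -/
theorem tendsto_greenHalfPlane_ratio :
    ∀ (A : Set ℂ), IsStarHull A →
      ∀ (Φ : ConformalEquiv (UpperHalfPlane.upperHalfPlaneSet \ A) UpperHalfPlane.upperHalfPlaneSet)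
        (d : ℝ), IsRestrictionMap A Φ → HasRestrictionDeriv A Φ d →
      Tendsto (fun p : ℂ × ℂ =>
          Real.log (‖Φ p.1 - (starRingEnd ℂ) (Φ p.2)‖ / ‖Φ p.1 - Φ p.2‖) /
            Real.log (‖p.1 - (starRingEnd ℂ) p.2‖ / ‖p.1 - p.2‖))
        (𝓝[UpperHalfPlane.upperHalfPlaneSet \ A] 0 ×ˢ
          (cocompact ℂ ⊓ 𝓟 (UpperHalfPlane.upperHalfPlaneSet \ A))) (𝓝 d) := by
  intro A hA Φ d hΦ hd
  set F : Filter (ℂ × ℂ) := 𝓝[UpperHalfPlane.upperHalfPlaneSet \ A] 0 ×ˢ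
    (cocompact ℂ ⊓ 𝓟 (UpperHalfPlane.upperHalfPlaneSet \ A)) with hF
  -- the two coordinate filters
  have hfst : Tendsto Prod.fst F (𝓝[UpperHalfPlane.upperHalfPlaneSet \ A] 0) := tendsto_fst
  have hsnd : Tendsto Prod.snd F (cocompact ℂ ⊓ 𝓟 (UpperHalfPlane.upperHalfPlaneSet \ A)) :=
    tendsto_snd
  have hu0 : Tendsto (fun p : ℂ × ℂ => p.1) F (𝓝 0) := hfst.mono_right nhdsWithin_le_nhds
  have hvco : Tendsto (fun p : ℂ × ℂ => p.2) F (cocompact ℂ) := hsnd.mono_right inf_le_left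
  have hv : Tendsto (fun p : ℂ × ℂ => ‖p.2‖) F atTop := tendsto_norm_cocompact_atTop.comp hvco
  have hvinv : Tendsto (fun p : ℂ × ℂ => (p.2)⁻¹) F (𝓝 0) := by
    rw [← Metric.cobounded_eq_cocompact] at hvco
    exact tendsto_inv₀_cobounded.comp hvco
  have hvninv : Tendsto (fun p : ℂ × ℂ => ‖p.2‖⁻¹) F (𝓝 0) := tendsto_inv_atTop_zero.comp hv
  have hmem1 : ∀ᶠ p in F, p.1 ∈ UpperHalfPlane.upperHalfPlaneSet \ A :=
    hfst.eventually eventually_mem_nhdsWithin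
  have hmem2 : ∀ᶠ p in F, p.2 ∈ UpperHalfPlane.upperHalfPlaneSet \ A :=
    hsnd.eventually (mem_inf_of_right (mem_principal_self _))
  -- the four analytic inputs
  have hA1 : Tendsto (fun p : ℂ × ℂ => (Φ p.1).im / (p.1).im) F (𝓝 d) :=
    (hΦ.tendsto_im_div_im_nhdsWithin_zero hA hd).comp hfst
  have hA2 : Tendsto (fun p : ℂ × ℂ => (Φ p.2).im / (p.2).im) F (𝓝 1) :=
    (tendsto_im_div_im_cocompact hA.1 hΦ).comp hsnd
  have hΦ0 : Tendsto (fun p : ℂ × ℂ => Φ p.1) F (𝓝 0) := hΦ.1.comp hfst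
  have hΦv : Tendsto (fun p : ℂ × ℂ => Φ p.2 / p.2) F (𝓝 1) := hΦ.2.comp hsnd
  -- `|u - v|/|v| → 1` and `|Φu - Φv|/|v| → 1`
  have hK1 : Tendsto (fun p : ℂ × ℂ => ‖p.1 - p.2‖ / ‖p.2‖) F (𝓝 1) := by
    have h : Tendsto (fun p : ℂ × ℂ => ‖p.1 * (p.2)⁻¹ - 1‖) F (𝓝 ‖(0 : ℂ) * 0 - 1‖) :=
      ((hu0.mul hvinv).sub_const 1).norm
    rw [zero_mul, zero_sub, norm_neg, norm_one] at h
    refine h.congr' ?_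
    filter_upwards [hv.eventually_gt_atTop 0] with p hp
    have hp0 : p.2 ≠ 0 := norm_pos_iff.1 hp
    show ‖p.1 * (p.2)⁻¹ - 1‖ = ‖p.1 - p.2‖ / ‖p.2‖
    rw [← norm_div, sub_div, div_self hp0, div_eq_mul_inv]
  have hK2 : Tendsto (fun p : ℂ × ℂ => ‖Φ p.1 - Φ p.2‖ / ‖p.2‖) F (𝓝 1) := by
    have h : Tendsto (fun p : ℂ × ℂ => ‖Φ p.1 * (p.2)⁻¹ - Φ p.2 / p.2‖) F (𝓝 ‖(0 : ℂ) * 0 - 1‖) :=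
      ((hΦ0.mul hvinv).sub hΦv).norm
    rw [zero_mul, zero_sub, norm_neg, norm_one] at h
    refine h.congr' (Eventually.of_forall fun p => ?_)
    show ‖Φ p.1 * (p.2)⁻¹ - Φ p.2 / p.2‖ = ‖Φ p.1 - Φ p.2‖ / ‖p.2‖
    rw [← norm_div, sub_div]
    simp only [div_eq_mul_inv]
  -- eventually: `u ≠ v`, `Φu ≠ Φv`, all imaginary parts positive
  have hne : ∀ᶠ p in F, p.1 ≠ p.2 := by
    have h1 : ∀ᶠ p in F, ‖p.1‖ < 1 := by
      have := hu0.norm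
      rw [norm_zero] at this
      exact this.eventually (gt_mem_nhds one_pos)
    filter_upwards [h1, hv.eventually_gt_atTop 1] with p hp1 hp2 heq
    rw [heq] at hp1
    linarith
  have hneΦ : ∀ᶠ p in F, Φ p.1 ≠ Φ p.2 := by
    filter_upwards [hne, hmem1, hmem2] with p hp h1 h2 heq
    exact hp (Φ.injOn h1 h2 heq)
  -- the small parameters `t = 4 Im u Im v/|u - v|²` and `t' = 4 Im Φu Im Φv/|Φu - Φv|²`
  set t : ℂ × ℂ → ℝ := fun p => 4 * (p.1).im * (p.2).im / ‖p.1 - p.2‖ ^ 2 with ht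
  set t' : ℂ × ℂ → ℝ := fun p => 4 * (Φ p.1).im * (Φ p.2).im / ‖Φ p.1 - Φ p.2‖ ^ 2 with ht'
  have ht_pos : ∀ᶠ p in F, 0 < t p := by
    filter_upwards [hne, hmem1, hmem2] with p hp h1 h2
    have ha : 0 < (p.1).im := h1.1
    have hb : 0 < (p.2).im := h2.1
    have hD : 0 < ‖p.1 - p.2‖ := norm_pos_iff.2 (sub_ne_zero.2 hp)
    simp only [ht]
    positivity
  have ht'_pos : ∀ᶠ p in F, 0 < t' p := by
    filter_upwards [hneΦ, hmem1, hmem2] with p hp h1 h2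
    have ha : 0 < (Φ p.1).im := Φ.mapsTo h1
    have hb : 0 < (Φ p.2).im := Φ.mapsTo h2
    have hD : 0 < ‖Φ p.1 - Φ p.2‖ := norm_pos_iff.2 (sub_ne_zero.2 hp)
    simp only [ht']
    positivity
  -- `t → 0`: `0 < t ≤ 4 |u| |v|⁻¹/(|u - v|/|v|)² → 0`
  have ht0 : Tendsto t F (𝓝 0) := by
    have hB : Tendsto (fun p : ℂ × ℂ => 4 * ‖p.1‖ * ‖p.2‖⁻¹ / (‖p.1 - p.2‖ / ‖p.2‖) ^ 2) F
        (𝓝 (4 * ‖(0 : ℂ)‖ * 0 / 1 ^ 2)) :=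
      ((hu0.norm.const_mul 4).mul hvninv).div (hK1.pow 2) (by norm_num)
    norm_num at hB
    refine tendsto_of_tendsto_of_tendsto_of_le_of_le' tendsto_const_nhds hB
      (ht_pos.mono fun p hp => hp.le) ?_
    filter_upwards [hne, hmem1, hmem2, hv.eventually_gt_atTop 0] with p hp h1 h2 hv0
    have ha : 0 < (p.1).im := h1.1
    have hb : 0 < (p.2).im := h2.1
    have hD : 0 < ‖p.1 - p.2‖ := norm_pos_iff.2 (sub_ne_zero.2 hp)
    have ha' : (p.1).im ≤ ‖p.1‖ := Complex.im_le_norm _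
    have hb' : (p.2).im ≤ ‖p.2‖ := Complex.im_le_norm _
    have heq : 4 * ‖p.1‖ * ‖p.2‖⁻¹ / (‖p.1 - p.2‖ / ‖p.2‖) ^ 2 =
        4 * ‖p.1‖ * ‖p.2‖ / ‖p.1 - p.2‖ ^ 2 := by
      field_simp
    simp only [ht]
    rw [heq, div_le_div_iff_of_pos_right (by positivity)]
    nlinarith [mul_le_mul ha' hb' hb.le (norm_nonneg _)]
  -- `t'/t → d · 1 · 1`
  have hratio : Tendsto (fun p => t' p / t p) F (𝓝 d) := by
    have h : Tendsto (fun p : ℂ × ℂ => (Φ p.1).im / (p.1).im * ((Φ p.2).im / (p.2).im) *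
        ((‖p.1 - p.2‖ / ‖p.2‖) ^ 2 / (‖Φ p.1 - Φ p.2‖ / ‖p.2‖) ^ 2)) F
        (𝓝 (d * 1 * (1 ^ 2 / 1 ^ 2))) :=
      (hA1.mul hA2).mul ((hK1.pow 2).div (hK2.pow 2) (by norm_num))
    rw [mul_one, one_pow, div_one, mul_one] at h
    refine h.congr' ?_
    filter_upwards [hne, hneΦ, hmem1, hmem2, hv.eventually_gt_atTop 0] with p hp hpΦ h1 h2 hv0
    have ha : 0 < (p.1).im := h1.1
    have hb : 0 < (p.2).im := h2.1
    have hD : 0 < ‖p.1 - p.2‖ := norm_pos_iff.2 (sub_ne_zero.2 hp)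
    have hD' : 0 < ‖Φ p.1 - Φ p.2‖ := norm_pos_iff.2 (sub_ne_zero.2 hpΦ)
    simp only [ht, ht']
    field_simp
  -- `t' → 0`
  have ht'0 : Tendsto t' F (𝓝 0) := by
    have h := hratio.mul ht0
    rw [mul_zero] at h
    refine h.congr' ?_
    filter_upwards [ht_pos] with p hp
    exact div_mul_cancel₀ _ hp.ne'
  -- `log(1 + t)/t → 1`, `log(1 + t')/t' → 1`
  have htL : Tendsto (fun p => Real.log (1 + t p) / t p) F (𝓝 1) :=
    tendsto_log_one_add_div.comp (tendsto_nhdsWithin_iff.2 ⟨ht0, ht_pos.mono fun p hp => hp.ne'⟩)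
  have ht'L : Tendsto (fun p => Real.log (1 + t' p) / t' p) F (𝓝 1) :=
    tendsto_log_one_add_div.comp (tendsto_nhdsWithin_iff.2 ⟨ht'0, ht'_pos.mono fun p hp => hp.ne'⟩)
  -- assemble
  have hlim : Tendsto (fun p => Real.log (1 + t' p) / t' p * (t' p / t p) /
      (Real.log (1 + t p) / t p)) F (𝓝 (1 * d / 1)) := (ht'L.mul hratio).div htL one_ne_zero
  rw [one_mul, div_one] at hlim
  refine hlim.congr' ?_
  filter_upwards [hne, hneΦ, hmem1, hmem2, ht_pos, ht'_pos] with p hp hpΦ h1 h2 htp ht'p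
  have ha : 0 < (p.1).im := h1.1
  have hb : 0 < (p.2).im := h2.1
  have ha' : 0 < (Φ p.1).im := Φ.mapsTo h1
  have hb' : 0 < (Φ p.2).im := Φ.mapsTo h2
  have hlog : Real.log (1 + t p) ≠ 0 := (Real.log_pos (by linarith)).ne'
  have hlog' : Real.log (1 + t' p) ≠ 0 := (Real.log_pos (by linarith)).ne'
  have htp' : t p ≠ 0 := htp.ne'
  have ht'p' : t' p ≠ 0 := ht'p.ne'
  rw [log_norm_sub_conj_div hpΦ ha'.le hb'.le, log_norm_sub_conj_div hp ha.le hb.le]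
  show Real.log (1 + t' p) / t' p * (t' p / t p) / (Real.log (1 + t p) / t p) =
    Real.log (1 + t' p) / 2 / (Real.log (1 + t p) / 2)
  field_simp

end GreenRatio

end Summit.CriticalPhenomena.SAWScalingLimit.Theorems.AvoidanceLimit.Anchor

end
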